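import Summits.ABC.ABC.Theses.IUTThetaPilot
import Summits.ABC.IUTFork.LDHGenuinePoint
import HarnessLib

/-!
# Crux `ThetaPartII` (stmt-ABC-19678, route IUTThetaPilot), registered stub `stub_hullVolume` (child (ii′)):
# the glue from abc-iut-c312-d1's explicit Step-(v) constant (route S-a)

Helper lemmas for the REGISTERED stub `stub_hullVolume` of the layer-2 skeleton `Display` v1.2 (sha16
08436f6de68ed80c; `ledger skeleton check --crux stmt-ABC-19678`):

  `∀ P ∈ UP, ∀ l prime, 5 ≤ l → AdmitsCore P → CondP2 P l → CondP5 P l → CondP6 P l →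
     Cor22.HullVolumeAtDatum P l B_III(P,l)`,

`B_III(P,l) = (l+1)/4·{(1 + 12·d_mod/l)·(log-diff + log 𝔣^{∤{2,l}}) + 2·log l + 52 + (20/3)·log(d*·l)·π(d*·l)}`
([IUTchIV] Thm. 1.10 Step (v) final display p. 29 summed, with the Step (iii) FINAL display p. 26, `𝔰^≤` p. 25 and
`e_mod ≤ d_mod` p. 22 substituted; abc-iut-plan ruling 2026-08-26T02:24:55Z). The route owner's support plan
(2026-08-26T01:44:52Z, RESHAPE-2) names the glue «`DHData.hullEstimateOf_ofInput_explicit` + c312-8's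
`hullVolume_of_explicitDelta` + mono»; this PROOF-ONLY file lands the c312-8 half BY NAME in the tree:

* `ThetaPartII.hullVolumeAtDatum_mono` — `δ ≤ δ' → HullVolumeAtDatum P l δ → HullVolumeAtDatum P l δ'`;
* `ThetaPartII.hullVolumeAtDatum_of_explicitDelta_le` — if abc-iut-c312-d1's explicit constant of every genuine
  datum at `(P, l)` is `≤ B`, then `HullVolumeAtDatum P l B` (abc-iut-S2's `PointDict.hullEstimateOf_at`:
  `T.HullEstimateOf (explicitDelta T.I)` is a THEOREM, p414439/p417796);
* `ThetaPartII.stub_hullVolume_of_explicitDelta` — the registered stub (exact B_III bytes) from the pointwise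
  bound `explicitDelta T.I ≤ B_III(P,l)` under the stub's own binders (route S-a: abc-iut-c312-d1's
  `DHData.hullEstimateOf_ofInput_explicit` + abc-iut-S3's `Cor22.deltaK_le_BIII` supply it on the slot-constant
  regime).

Pure bookkeeping (monotonicity in `δ` of `negLogThetaNonarch ≤ −deĝ̲_lgp + δ`); TAKES NO SIDE on [IUTchIII]
Cor. 3.12 or on [IUTchIV] Thm. 1.10 Step (v). [cite: Mochizuki2012, IUTchIV Thm. 1.10 proof Step (v) p. 29]
[claim: Mochizuki2012, status: disputed] for the IUT locators only.
-/

noncomputable section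

-- `Summit.<Summit>.<Problem>` is the mandated summit-side namespace (CONVENTIONS §2).
set_option linter.dupNamespace false

namespace Summit.ABC.ABC.Theorems

namespace ThetaPartII

open Literature.NumberTheory.DiophantineGeometry.GenEll
open Literature.IUT.LogVolume

/-- **Monotonicity of the computable half in `δ`**: `HullVolumeAtDatum P l δ → δ ≤ δ' → HullVolumeAtDatum P l δ'`
(each datum's `HullEstimateOf δ` is `negLogThetaNonarch ≤ −deĝ̲_lgp(P_Θ) + δ`).
[cite: Mochizuki2012, IUTchIV Thm. 1.10 proof Step (v) p. 29] -/
theorem hullVolumeAtDatum_mono {P : NFPoint} {l : ℕ} {δ δ' : ℝ} (hδ : δ ≤ δ')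
    (h : Cor22.HullVolumeAtDatum P l δ) : Cor22.HullVolumeAtDatum P l δ' := by
  intro T
  letI := T.instFieldF; letI := T.instNumberFieldF; letI := T.instFieldK
  letI := T.instNumberFieldK; letI := T.instAlgebraK
  have h1 : T.I.negLogThetaNonarch ≤ -LgpDivisor.ndegLgp T.I.X.thetaPilot + δ := h T
  show T.I.negLogThetaNonarch ≤ -LgpDivisor.ndegLgp T.I.X.thetaPilot + δ'
  linarith

/-- **abc-iut-c312-d1's explicit constant bounds the computable half**: if `explicitDelta T.I ≤ B` for every
genuine Θ-volume datum `T` at `(P, l)`, then `Cor22.HullVolumeAtDatum P l B` — by abc-iut-S2's THEOREM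
`PointDict.hullEstimateOf_at : T.HullEstimateOf (explicitDelta T.I)` and monotonicity.
[cite: Mochizuki2012, IUTchIV Thm. 1.10 proof Step (v) p. 29] -/
theorem hullVolumeAtDatum_of_explicitDelta_le {P : NFPoint} {l : ℕ} {B : ℝ}
    (h : ∀ T : Cor22.ThetaVolumeDatumAt P l,
      (letI := T.instFieldF; letI := T.instNumberFieldF; letI := T.instFieldK
       letI := T.instNumberFieldK; letI := T.instAlgebraK
       Summit.ABC.IUTFork.DHData.explicitDelta T.I) ≤ B) :
    Cor22.HullVolumeAtDatum P l B := by
  intro T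
  letI := T.instFieldF; letI := T.instNumberFieldF; letI := T.instFieldK
  letI := T.instNumberFieldK; letI := T.instAlgebraK
  have h1 : T.I.negLogThetaNonarch ≤
      -LgpDivisor.ndegLgp T.I.X.thetaPilot + Summit.ABC.IUTFork.DHData.explicitDelta T.I :=
    Summit.ABC.IUTFork.PointDict.hullEstimateOf_at T
  have h2 := h T
  show T.I.negLogThetaNonarch ≤ _
  linarith

/-- **The registered `stub_hullVolume` from the route S-a bound**: if, under the stub's own binders, every
genuine datum `T` at `(P, l)` has `explicitDelta T.I ≤ B_III(P,l)`, then `stub_hullVolume` (skeleton v1.2, exact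
bytes) holds. [cite: Mochizuki2012, IUTchIV Thm. 1.10 proof Step (v) p. 29] -/
theorem stub_hullVolume_of_explicitDelta
    (h : ∀ P : NFPoint, P ∈ UP → ∀ l : ℕ, l.Prime → 5 ≤ l →
      Cor22.AdmitsCore P → Cor22.CondP2 P l → Cor22.CondP5 P l → Cor22.CondP6 P l →
        ∀ T : Cor22.ThetaVolumeDatumAt P l,
          (letI := T.instFieldF; letI := T.instNumberFieldF; letI := T.instFieldK
           letI := T.instNumberFieldK; letI := T.instAlgebraK
           Summit.ABC.IUTFork.DHData.explicitDelta T.I) ≤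
            ((l : ℝ) + 1) / 4 *
              ((1 + 12 * (Cor22.dmod P : ℝ) / l) * (P.logDiff + Cor22.logCondAvoid P {2, l})
                + 2 * Real.log l + 52
                + 20 / 3 * Real.log (((2 ^ 12 * 3 ^ 3 * 5 * Cor22.dmod P : ℕ) : ℝ) * (l : ℝ))
                  * (Nat.primeCounting (2 ^ 12 * 3 ^ 3 * 5 * Cor22.dmod P * l) : ℝ))) :
    ∀ P : NFPoint, P ∈ UP → ∀ l : ℕ, l.Prime → 5 ≤ l →
      Cor22.AdmitsCore P → Cor22.CondP2 P l → Cor22.CondP5 P l → Cor22.CondP6 P l →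
      Cor22.HullVolumeAtDatum P l
        (((l : ℝ) + 1) / 4 *
          ((1 + 12 * (Cor22.dmod P : ℝ) / l) * (P.logDiff + Cor22.logCondAvoid P {2, l})
            + 2 * Real.log l + 52
            + 20 / 3 * Real.log (((2 ^ 12 * 3 ^ 3 * 5 * Cor22.dmod P : ℕ) : ℝ) * (l : ℝ))
              * (Nat.primeCounting (2 ^ 12 * 3 ^ 3 * 5 * Cor22.dmod P * l) : ℝ))) :=
  fun P hP l hl h5 hc h2 hP5 h6 => hullVolumeAtDatum_of_explicitDelta_le (h P hP l hl h5 hc h2 hP5 h6)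

end ThetaPartII

end Summit.ABC.ABC.Theorems

end
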